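import Literature.Analysis.UnboundedOperators.WeaklySingularDuhamel
import Summits.AnomalousDissipation.AnomalousDissipation.Theorems.BaireTransferDenseLoudDesignerForcesErgodicLine

/-!
# The weakly singular Duhamel operator on `C([0, τ]; H)` (tools stub `stub_duhamelOperatorTools`, block N-R,
# line `ergodic-budget-selection-closing`, crux `BaireTransfer.DenseLoudDesignerForces`, stmt-AnomalousDissipation-1143)

Summit-side specialisation to the phase space `Hsp = H = L²_σ(T³)` (`…ErgodicLine.lean`) of the Literature theorem
`Literature.Analysis.UnboundedOperators.exists_duhamelCLM`
(`Literature/Analysis/UnboundedOperators/WeaklySingularDuhamel.lean`, general real Banach space `E`): for `τ > 0`,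
`α < 1`, `C ≥ 0` and a family `K : ℝ → L(H)` with the weakly singular bound `‖K t‖ ≤ C t^{-α}` (`t > 0`) which is
strongly continuous on `(0, ∞)`, the Duhamel (variation-of-constants) operator

  `(Φ G)(t) = ∫₀ᵗ K(t − s) G(s) ds`   (`G ∈ C([0, τ]; H)` extended to `ℝ` by constants through `Set.projIcc`)

is a continuous linear operator `Φ : C([0, τ]; H) →L[ℝ] C([0, τ]; H)` of norm `‖Φ‖ ≤ C τ^{1−α} / (1 − α)`
(Pazy 1983, §6.3, proof of Thm 3.1, the map `F` of (3.7) with the estimate (3.9); Henry 1981, Lemma 3.3.2 /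
Thm 3.3.3).  Block N-R applies it to the smoothing family `K t = A^{3/4} e^{-tA}` of the Stokes operator
(`α = 3/4`, tools stub S1) to build the mild Picard map `y ↦ e^{-νtA} y₀ − Φ(N(y, y)) + forcing` on `C([0, τ]; H)`
whose fixed point is the smooth model of the Navier–Stokes semiflow.  The registered tools stub
`stub_duhamelOperatorTools` is proved BY NAME with exactly the registered signature (its hypothesis `0 ≤ α` is not
needed by the estimate, which holds for every `α < 1`).

References: A. Pazy, *Semigroups of Linear Operators and Applications to PDE* (1983) §6.3 Thm 3.1; D. Henry,
*Geometric Theory of Semilinear Parabolic Equations* (1981) Lemma 3.3.2, Thm 3.3.3.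
-/

-- `Summit.<Summit>.<Problem>` is the tree's mandated summit-side namespace (CONVENTIONS §2); for this
-- single-conjunct summit the two coincide, so the duplicate is deliberate.
set_option linter.dupNamespace false

noncomputable section

open scoped BigOperators Topology ENNReal InnerProductSpace
open Filter Set Function MeasureTheory

namespace Summit.AnomalousDissipation.AnomalousDissipation.Theorems.DenseLoudDesignerForces.Ergodic

open Literature.Analysis.FunctionSpaces Literature.Analysis.FunctionSpaces.Torus
open Literature.Analysis.FluidPDE Literature.Analysis.FluidPDE.Torus

/-- **Tools stub S2 of block N-R (`stub_duhamelOperatorTools`, crux stmt-AnomalousDissipation-1143, line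
`ergodic-budget-selection-closing`) — the weakly singular Duhamel operator on `C([0, τ]; H)`.**  For `τ > 0`,
`0 ≤ α < 1`, `C ≥ 0` and `K : ℝ → L(H)` with `‖K t‖ ≤ C t^{-α}` for `t > 0` and `t ↦ K t y` continuous on
`(0, ∞)` for every `y`, there is a continuous linear operator `Φ` on `C([0, τ]; H)` with
`(Φ G)(t) = ∫₀ᵗ K(t − s) G(s) ds` (`G` extended by constants through `Set.projIcc`) and
`‖Φ‖ ≤ C τ^{1−α} / (1 − α)` — `Literature.Analysis.UnboundedOperators.exists_duhamelCLM` at `E := Hsp`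
(Pazy 1983, §6.3, proof of Thm 3.1, (3.7)–(3.9)). [cite: Pazy1983, §6.3, proof of Thm 3.1, (3.7)–(3.9)] -/
theorem stub_duhamelOperatorTools {τ α C : ℝ} (hτ : 0 < τ) (hα₀ : 0 ≤ α) (hα : α < 1) (hC : 0 ≤ C) (K : ℝ → Hsp →L[ℝ] Hsp)
    (hK : ∀ t, 0 < t → ‖K t‖ ≤ C * t ^ (-α)) (hKc : ∀ y : Hsp, ContinuousOn (fun t : ℝ => K t y) (Ioi 0)) :
    ∃ Φ : C(Icc (0 : ℝ) τ, Hsp) →L[ℝ] C(Icc (0 : ℝ) τ, Hsp),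
      (∀ (G : C(Icc (0 : ℝ) τ, Hsp)) (t : Icc (0 : ℝ) τ),
        Φ G t = ∫ s in (0 : ℝ)..(t : ℝ), K ((t : ℝ) - s) (G (Set.projIcc 0 τ hτ.le s))) ∧
      ‖Φ‖ ≤ C * τ ^ (1 - α) / (1 - α) := by
  -- `hα₀ : 0 ≤ α` belongs to the registered signature; the Literature estimate needs only `α < 1`.
  have _h : 0 ≤ α := hα₀
  exact Literature.Analysis.UnboundedOperators.exists_duhamelCLM hτ hα hC K hK hKc

end Summit.AnomalousDissipation.AnomalousDissipation.Theorems.DenseLoudDesignerForces.Ergodic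

end
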